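import Summits.Ventures.HSemireg.WedgeHankelBoxSiegelIdealKernel

/-!
# Venture HSemireg — THE BOX SIEGEL IDEAL, closed rows: two surfaces, a surface times a threefold, three curves

HONEST FRAMING. Part of the Lean index of the computation cell `pub-hsemireg` (seat p10 gen 12, Sunday typer «UNIFORM-IN-n»).  Binomial arithmetic on top of
(2/3) `WedgeHankelBoxSiegelIdealKernel` ONLY; nothing here says that HC / HC_CM / HC_AV holds; no Literature fact is declared or used.  The dictionary
(`boxSiegelIdeal_k` = the isotropic part of `HT^k(X₀ × ⋯ × X_{n−1})` killed by every external product of `K[Θ_i]`-classes) is QUOTED, never asserted.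

THIS FILE (namespace `Summit.Ventures.HSemireg.Wedge.HankelBoxSiegelIdeal` continued): the numbers `dim boxSiegelIdeal_k = C(Σ 2m_i, k) − [t^k] Π_i G_{m_i}(t)` of (2/3) for three
small boxes, every degree `k`, as kernel-checked tables (`decide` on the closed coefficients; cf. gen 6's `mixedRank_rows`):
* two SURFACES (`m = (2,2)`, `G_2 = 1 + 4t + 3t²`): `[t^k] G_2² = (1, 8, 22, 24, 9)`, `C(8,k) = (1, 8, 28, 56, 70, 56, 28, 8, 1)` ⇒ **`dim boxSiegelIdeal_k = (0, 0, 6, 32, 61, 56, 28, 8, 1)`**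
  (degree 2: `6 = 3 + 3 = dim SiegelBox`; degrees `≥ 5`: everything);
* a SURFACE times a THREEFOLD (`m = (2,3)`, `G_3 = 1 + 6t + 9t² + 4t³`): `[t^k] G_2 G_3 = (1, 10, 36, 58, 43, 12)`, `C(10,k)` ⇒ **`(0, 0, 9, 62, 167, 240, 210, 120, 45, 10, 1)`**
  (degree 2: `9 = 3 + 6 = dim SiegelBox`);
* three CURVES (`m = (1,1,1)`, `G_1 = 1 + 2t`): `[t^k] G_1³ = (1, 6, 12, 8)`, `C(6,k)` ⇒ **`(0, 0, 3, 12, 15, 6, 1)`** (degree 2: the three Siegel lines `x_i y_i`).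
Stated as `finrank` theorems via `finrank_boxSiegelIdeal`.  Class side only.
-/

open Module Polynomial

namespace Summit.Ventures.HSemireg.Wedge.HankelBoxSiegelIdeal

open Summit.Ventures.HSemireg.Wedge Summit.Ventures.HSemireg.Wedge.MixedBox

variable (K : Type*) [Field K]

/-- `[t^k] G_{m₁} G_{m₂} = Σ_{i ≤ k} (i+1)C(m₁,i)·(k−i+1)C(m₂,k−i)`. -/
lemma coeff_stdPoly_mul (m₁ m₂ k : ℕ) :
    (stdPoly m₁ * stdPoly m₂).coeff k = ∑ i ∈ Finset.range (k + 1), ((i + 1) * m₁.choose i) * ((k - i + 1) * m₂.choose (k - i)) := by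
  rw [coeff_mul, Finset.Nat.sum_antidiagonal_eq_sum_range_succ (fun i j => (stdPoly m₁).coeff i * (stdPoly m₂).coeff j) k]
  simp only [coeff_stdPoly]

/-- `[t^k] G_{m₁} G_{m₂} G_{m₃}` as a double sum. -/
lemma coeff_stdPoly_mul₃ (m₁ m₂ m₃ k : ℕ) :
    (stdPoly m₁ * stdPoly m₂ * stdPoly m₃).coeff k =
      ∑ j ∈ Finset.range (k + 1), (∑ i ∈ Finset.range (j + 1), ((i + 1) * m₁.choose i) * ((j - i + 1) * m₂.choose (j - i))) * ((k - j + 1) * m₃.choose (k - j)) := by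
  rw [coeff_mul, Finset.Nat.sum_antidiagonal_eq_sum_range_succ (fun i j => (stdPoly m₁ * stdPoly m₂).coeff i * (stdPoly m₃).coeff j) k]
  simp only [coeff_stdPoly_mul, coeff_stdPoly]

/-- **TWO SURFACES (`m = (2,2)`): `dim boxSiegelIdeal_k = (0, 0, 6, 32, 61, 56, 28, 8, 1)` for `k = 0, …, 8`.** -/
theorem finrank_boxSiegelIdeal_two_surfaces :
    (finrank K (boxSiegelIdeal K ![2, 2] 0), finrank K (boxSiegelIdeal K ![2, 2] 1), finrank K (boxSiegelIdeal K ![2, 2] 2),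
      finrank K (boxSiegelIdeal K ![2, 2] 3), finrank K (boxSiegelIdeal K ![2, 2] 4), finrank K (boxSiegelIdeal K ![2, 2] 5),
      finrank K (boxSiegelIdeal K ![2, 2] 6), finrank K (boxSiegelIdeal K ![2, 2] 7), finrank K (boxSiegelIdeal K ![2, 2] 8)) =
      (0, 0, 6, 32, 61, 56, 28, 8, 1) := by
  have h : ∀ k, finrank K (boxSiegelIdeal K ![2, 2] k) + (stdPoly 2 * stdPoly 2).coeff k = (8 : ℕ).choose k := by
    intro k
    have := finrank_boxSiegelIdeal K ![2, 2] k
    rwa [Fin.prod_univ_two, Fin.sum_univ_two] at this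
  have hc : ∀ k, (stdPoly 2 * stdPoly 2).coeff k = ∑ i ∈ Finset.range (k + 1), ((i + 1) * (2 : ℕ).choose i) * ((k - i + 1) * (2 : ℕ).choose (k - i)) :=
    coeff_stdPoly_mul 2 2
  have e0 := h 0; have e1 := h 1; have e2 := h 2; have e3 := h 3; have e4 := h 4; have e5 := h 5; have e6 := h 6; have e7 := h 7; have e8 := h 8
  rw [hc] at e0 e1 e2 e3 e4 e5 e6 e7 e8
  have t0 : (∑ i ∈ Finset.range (0 + 1), ((i + 1) * (2 : ℕ).choose i) * ((0 - i + 1) * (2 : ℕ).choose (0 - i))) = 1 ∧ (8 : ℕ).choose 0 = 1 := by decide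
  have t1 : (∑ i ∈ Finset.range (1 + 1), ((i + 1) * (2 : ℕ).choose i) * ((1 - i + 1) * (2 : ℕ).choose (1 - i))) = 8 ∧ (8 : ℕ).choose 1 = 8 := by decide
  have t2 : (∑ i ∈ Finset.range (2 + 1), ((i + 1) * (2 : ℕ).choose i) * ((2 - i + 1) * (2 : ℕ).choose (2 - i))) = 22 ∧ (8 : ℕ).choose 2 = 28 := by decide
  have t3 : (∑ i ∈ Finset.range (3 + 1), ((i + 1) * (2 : ℕ).choose i) * ((3 - i + 1) * (2 : ℕ).choose (3 - i))) = 24 ∧ (8 : ℕ).choose 3 = 56 := by decide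
  have t4 : (∑ i ∈ Finset.range (4 + 1), ((i + 1) * (2 : ℕ).choose i) * ((4 - i + 1) * (2 : ℕ).choose (4 - i))) = 9 ∧ (8 : ℕ).choose 4 = 70 := by decide
  have t5 : (∑ i ∈ Finset.range (5 + 1), ((i + 1) * (2 : ℕ).choose i) * ((5 - i + 1) * (2 : ℕ).choose (5 - i))) = 0 ∧ (8 : ℕ).choose 5 = 56 := by decide
  have t6 : (∑ i ∈ Finset.range (6 + 1), ((i + 1) * (2 : ℕ).choose i) * ((6 - i + 1) * (2 : ℕ).choose (6 - i))) = 0 ∧ (8 : ℕ).choose 6 = 28 := by decide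
  have t7 : (∑ i ∈ Finset.range (7 + 1), ((i + 1) * (2 : ℕ).choose i) * ((7 - i + 1) * (2 : ℕ).choose (7 - i))) = 0 ∧ (8 : ℕ).choose 7 = 8 := by decide
  have t8 : (∑ i ∈ Finset.range (8 + 1), ((i + 1) * (2 : ℕ).choose i) * ((8 - i + 1) * (2 : ℕ).choose (8 - i))) = 0 ∧ (8 : ℕ).choose 8 = 1 := by decide
  simp only [Prod.mk.injEq]
  refine ⟨?_, ?_, ?_, ?_, ?_, ?_, ?_, ?_, ?_⟩ <;> omega

/-- **A SURFACE TIMES A THREEFOLD (`m = (2,3)`): `dim boxSiegelIdeal_k = (0, 0, 9, 62, 167, 240, 210, 120, 45, 10, 1)` for `k = 0, …, 10`** (degree 2: `9 = 3 + 6`). -/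
theorem finrank_boxSiegelIdeal_surface_threefold :
    (finrank K (boxSiegelIdeal K ![2, 3] 0), finrank K (boxSiegelIdeal K ![2, 3] 1), finrank K (boxSiegelIdeal K ![2, 3] 2),
      finrank K (boxSiegelIdeal K ![2, 3] 3), finrank K (boxSiegelIdeal K ![2, 3] 4), finrank K (boxSiegelIdeal K ![2, 3] 5),
      finrank K (boxSiegelIdeal K ![2, 3] 6), finrank K (boxSiegelIdeal K ![2, 3] 7), finrank K (boxSiegelIdeal K ![2, 3] 8),
      finrank K (boxSiegelIdeal K ![2, 3] 9), finrank K (boxSiegelIdeal K ![2, 3] 10)) =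
      (0, 0, 9, 62, 167, 240, 210, 120, 45, 10, 1) := by
  have h : ∀ k, finrank K (boxSiegelIdeal K ![2, 3] k) + (stdPoly 2 * stdPoly 3).coeff k = (10 : ℕ).choose k := by
    intro k
    have := finrank_boxSiegelIdeal K ![2, 3] k
    rwa [Fin.prod_univ_two, Fin.sum_univ_two] at this
  have hc : ∀ k, (stdPoly 2 * stdPoly 3).coeff k = ∑ i ∈ Finset.range (k + 1), ((i + 1) * (2 : ℕ).choose i) * ((k - i + 1) * (3 : ℕ).choose (k - i)) :=
    coeff_stdPoly_mul 2 3
  have e0 := h 0; have e1 := h 1; have e2 := h 2; have e3 := h 3; have e4 := h 4; have e5 := h 5; have e6 := h 6; have e7 := h 7; have e8 := h 8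
  have e9 := h 9; have e10 := h 10
  rw [hc] at e0 e1 e2 e3 e4 e5 e6 e7 e8 e9 e10
  have t0 : (∑ i ∈ Finset.range (0 + 1), ((i + 1) * (2 : ℕ).choose i) * ((0 - i + 1) * (3 : ℕ).choose (0 - i))) = 1 ∧ (10 : ℕ).choose 0 = 1 := by decide
  have t1 : (∑ i ∈ Finset.range (1 + 1), ((i + 1) * (2 : ℕ).choose i) * ((1 - i + 1) * (3 : ℕ).choose (1 - i))) = 10 ∧ (10 : ℕ).choose 1 = 10 := by decide
  have t2 : (∑ i ∈ Finset.range (2 + 1), ((i + 1) * (2 : ℕ).choose i) * ((2 - i + 1) * (3 : ℕ).choose (2 - i))) = 36 ∧ (10 : ℕ).choose 2 = 45 := by decide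
  have t3 : (∑ i ∈ Finset.range (3 + 1), ((i + 1) * (2 : ℕ).choose i) * ((3 - i + 1) * (3 : ℕ).choose (3 - i))) = 58 ∧ (10 : ℕ).choose 3 = 120 := by decide
  have t4 : (∑ i ∈ Finset.range (4 + 1), ((i + 1) * (2 : ℕ).choose i) * ((4 - i + 1) * (3 : ℕ).choose (4 - i))) = 43 ∧ (10 : ℕ).choose 4 = 210 := by decide
  have t5 : (∑ i ∈ Finset.range (5 + 1), ((i + 1) * (2 : ℕ).choose i) * ((5 - i + 1) * (3 : ℕ).choose (5 - i))) = 12 ∧ (10 : ℕ).choose 5 = 252 := by decide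
  have t6 : (∑ i ∈ Finset.range (6 + 1), ((i + 1) * (2 : ℕ).choose i) * ((6 - i + 1) * (3 : ℕ).choose (6 - i))) = 0 ∧ (10 : ℕ).choose 6 = 210 := by decide
  have t7 : (∑ i ∈ Finset.range (7 + 1), ((i + 1) * (2 : ℕ).choose i) * ((7 - i + 1) * (3 : ℕ).choose (7 - i))) = 0 ∧ (10 : ℕ).choose 7 = 120 := by decide
  have t8 : (∑ i ∈ Finset.range (8 + 1), ((i + 1) * (2 : ℕ).choose i) * ((8 - i + 1) * (3 : ℕ).choose (8 - i))) = 0 ∧ (10 : ℕ).choose 8 = 45 := by decide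
  have t9 : (∑ i ∈ Finset.range (9 + 1), ((i + 1) * (2 : ℕ).choose i) * ((9 - i + 1) * (3 : ℕ).choose (9 - i))) = 0 ∧ (10 : ℕ).choose 9 = 10 := by decide
  have t10 : (∑ i ∈ Finset.range (10 + 1), ((i + 1) * (2 : ℕ).choose i) * ((10 - i + 1) * (3 : ℕ).choose (10 - i))) = 0 ∧ (10 : ℕ).choose 10 = 1 := by decide
  simp only [Prod.mk.injEq]
  refine ⟨?_, ?_, ?_, ?_, ?_, ?_, ?_, ?_, ?_, ?_, ?_⟩ <;> omega

/-- **THREE CURVES (`m = (1,1,1)`): `dim boxSiegelIdeal_k = (0, 0, 3, 12, 15, 6, 1)` for `k = 0, …, 6`** (degree 2: the three Siegel lines `x_i ∧ y_i`). -/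
theorem finrank_boxSiegelIdeal_three_curves :
    (finrank K (boxSiegelIdeal K ![1, 1, 1] 0), finrank K (boxSiegelIdeal K ![1, 1, 1] 1), finrank K (boxSiegelIdeal K ![1, 1, 1] 2),
      finrank K (boxSiegelIdeal K ![1, 1, 1] 3), finrank K (boxSiegelIdeal K ![1, 1, 1] 4), finrank K (boxSiegelIdeal K ![1, 1, 1] 5),
      finrank K (boxSiegelIdeal K ![1, 1, 1] 6)) = (0, 0, 3, 12, 15, 6, 1) := by
  have h : ∀ k, finrank K (boxSiegelIdeal K ![1, 1, 1] k) + (stdPoly 1 * stdPoly 1 * stdPoly 1).coeff k = (6 : ℕ).choose k := by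
    intro k
    have := finrank_boxSiegelIdeal K ![1, 1, 1] k
    rwa [Fin.prod_univ_three, Fin.sum_univ_three] at this
  have hc : ∀ k, (stdPoly 1 * stdPoly 1 * stdPoly 1).coeff k = ∑ j ∈ Finset.range (k + 1),
      (∑ i ∈ Finset.range (j + 1), ((i + 1) * (1 : ℕ).choose i) * ((j - i + 1) * (1 : ℕ).choose (j - i))) * ((k - j + 1) * (1 : ℕ).choose (k - j)) :=
    coeff_stdPoly_mul₃ 1 1 1
  have e0 := h 0; have e1 := h 1; have e2 := h 2; have e3 := h 3; have e4 := h 4; have e5 := h 5; have e6 := h 6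
  rw [hc] at e0 e1 e2 e3 e4 e5 e6
  have t0 : (∑ j ∈ Finset.range (0 + 1), (∑ i ∈ Finset.range (j + 1), ((i + 1) * (1 : ℕ).choose i) * ((j - i + 1) * (1 : ℕ).choose (j - i))) * ((0 - j + 1) * (1 : ℕ).choose (0 - j))) = 1 ∧ (6 : ℕ).choose 0 = 1 := by decide
  have t1 : (∑ j ∈ Finset.range (1 + 1), (∑ i ∈ Finset.range (j + 1), ((i + 1) * (1 : ℕ).choose i) * ((j - i + 1) * (1 : ℕ).choose (j - i))) * ((1 - j + 1) * (1 : ℕ).choose (1 - j))) = 6 ∧ (6 : ℕ).choose 1 = 6 := by decide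
  have t2 : (∑ j ∈ Finset.range (2 + 1), (∑ i ∈ Finset.range (j + 1), ((i + 1) * (1 : ℕ).choose i) * ((j - i + 1) * (1 : ℕ).choose (j - i))) * ((2 - j + 1) * (1 : ℕ).choose (2 - j))) = 12 ∧ (6 : ℕ).choose 2 = 15 := by decide
  have t3 : (∑ j ∈ Finset.range (3 + 1), (∑ i ∈ Finset.range (j + 1), ((i + 1) * (1 : ℕ).choose i) * ((j - i + 1) * (1 : ℕ).choose (j - i))) * ((3 - j + 1) * (1 : ℕ).choose (3 - j))) = 8 ∧ (6 : ℕ).choose 3 = 20 := by decide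
  have t4 : (∑ j ∈ Finset.range (4 + 1), (∑ i ∈ Finset.range (j + 1), ((i + 1) * (1 : ℕ).choose i) * ((j - i + 1) * (1 : ℕ).choose (j - i))) * ((4 - j + 1) * (1 : ℕ).choose (4 - j))) = 0 ∧ (6 : ℕ).choose 4 = 15 := by decide
  have t5 : (∑ j ∈ Finset.range (5 + 1), (∑ i ∈ Finset.range (j + 1), ((i + 1) * (1 : ℕ).choose i) * ((j - i + 1) * (1 : ℕ).choose (j - i))) * ((5 - j + 1) * (1 : ℕ).choose (5 - j))) = 0 ∧ (6 : ℕ).choose 5 = 6 := by decide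
  have t6 : (∑ j ∈ Finset.range (6 + 1), (∑ i ∈ Finset.range (j + 1), ((i + 1) * (1 : ℕ).choose i) * ((j - i + 1) * (1 : ℕ).choose (j - i))) * ((6 - j + 1) * (1 : ℕ).choose (6 - j))) = 0 ∧ (6 : ℕ).choose 6 = 1 := by decide
  simp only [Prod.mk.injEq]
  refine ⟨?_, ?_, ?_, ?_, ?_, ?_, ?_⟩ <;> omega

end Summit.Ventures.HSemireg.Wedge.HankelBoxSiegelIdeal
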